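import Mathlib
import Literature.AlgebraicGeometry.Resolution.PCyclicBoundaryType
import Literature.AlgebraicGeometry.Resolution.RegularParameterFamilies
import Literature.AlgebraicGeometry.Resolution.KummerNormalForm

/-!
# Crux `PicoverLocalModel` (stmt-ResolutionOfSingularities-0557), line `SketchIdeator3`
# (giraud-cossart-normal-form) — endgame, local charts: the types of the boundary components

Helpers of the stub `stub_localCharts` (local log-regular charts on the normalised pulled-back
`p`-cyclic cover). At a point `w` of the regular base `W`, with `𝒪 = 𝒪_{W,w}` (regular local of
characteristic `p`) and `x_1, …, x_r ∈ 𝔪` the local equations of the boundary components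
through `w` (part of a regular system of parameters, in the cotangent form
`∑ α_i x_i ∈ 𝔪² ⇒ α_i ∈ 𝔪`), the Giraud normal form of the radicand `a` at `w`
(`GiraudNormalFormAt`) determines the TYPE (`IsKummerTypeAt` / `IsWoundTypeAt`,
`Literature/…/PCyclicBoundaryType.lean`) of `a` in the discrete valuation ring `𝒪_{(x_j)}` of
each boundary component `D_j`:

* `isKummerTypeAt_of_kummerForm` — Kummer form `a = g^p + v ∏ x_i^{A_i}` at `w`, `p ∤ A_j`
  ⇒ Kummer type along `D_j`;
* `isWoundTypeAt_of_kummerForm` — Kummer form at `w`, `p ∣ A_j` but `p ∤ A_{j₁}` ⇒ WOUND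
  type along `D_j` (the residue of `v ∏_{i ≠ j} x_i^{A_i}` in `Frac(𝒪/(x_j))` has
  `x_{j₁}`-multiplicity `A_{j₁} ≢ 0 (mod p)`, so it is not a `p`-th power);
* `isWoundTypeAt_of_woundForm` — wound/transversal form `a = g^p + (∏ x_i^{B_i})^p u` at `w`
  ⇒ wound type along every `D_j` (normality of the regular `𝒪/(x_j)`);
* `woundForm_of_forall_isWoundTypeAt` — CONSISTENCY: if `a` is in Giraud normal form at `w`
  and of wound type along every `D_j` (as read off at any other point of `D_j`), then the form
  at `w` is the wound/transversal one (the two types exclude each other in the DVR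
  `𝒪_{(x_j)}`, `IsWoundTypeAt.not_isKummerTypeAt`).

Since `𝒪_{(x_j)} = 𝒪_{W,η_j}` only depends on the component `D_j`, these show that near a
Kummer centre the boundary components with exponent divisible by `p` carry only
wound/transversal points, which is what makes the Kummer chart log regular there.
-/

noncomputable section

-- single-problem summit: the doubled namespace component `ResolutionOfSingularities` is the tree layout
set_option linter.dupNamespace false

open IsLocalRing Literature.AlgebraicGeometry.Resolution

namespace Summit.ResolutionOfSingularities.ResolutionOfSingularities.Theorems.PicoverLocalModel.LocalCharts

/-- Splitting off one factor of a finite product over `Fin r`. [folklore] -/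
theorem prod_pow_eq_prod_erase_mul {O : Type*} [CommMonoid O] {r : ℕ} (x : Fin r → O)
    (A : Fin r → ℕ) (j : Fin r) :
    ∏ i, x i ^ A i = (∏ i ∈ Finset.univ.erase j, x i ^ A i) * x j ^ A j := by
  rw [mul_comm]
  exact (Finset.mul_prod_erase Finset.univ (fun i => x i ^ A i) (Finset.mem_univ j)).symm

/-- A product of powers of the parameters other than `x_j`, times a unit, lies outside `(x_j)`.
[folklore] -/
theorem unit_mul_prod_erase_notMem {O : Type*} [CommRing O] [IsRegularLocalRing O] {r : ℕ}
    {x : Fin r → O} (hx : ∀ j, x j ∈ maximalIdeal O)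
    (hli : ∀ α : Fin r → O, ∑ i, α i * x i ∈ maximalIdeal O ^ 2 → ∀ i, α i ∈ maximalIdeal O)
    {v : O} (hv : IsUnit v) (A : Fin r → ℕ) (j : Fin r) :
    v * ∏ i ∈ Finset.univ.erase j, x i ^ A i ∉ Ideal.span {x j} := by
  haveI := RegularParameters.isPrime_span_singleton hx hli j
  intro hmem
  rcases (Ideal.IsPrime.mem_or_mem ‹_› hmem) with hv' | hprod
  · exact (Ideal.IsPrime.ne_top ‹_›) (Ideal.eq_top_of_isUnit_mem _ hv' hv)
  · obtain ⟨i, hi, hmem'⟩ := Ideal.IsPrime.prod_mem_iff.mp hprod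
    have hxi : x i ∈ Ideal.span {x j} := Ideal.IsPrime.mem_of_pow_mem ‹_› _ hmem'
    exact RegularParameters.notMem_sq_sup_span_singleton hli (Finset.ne_of_mem_erase hi)
      (Ideal.mem_sup_right hxi)

/-- **Kummer form at a point, `p ∤ A_j` ⇒ Kummer type along `D_j`.** For a regular local ring
`𝒪`, regular parameters `x_i`, and `a = g^p + v ∏ x_i^{A_i}` with `v` a unit: if `p ∤ A_j`
then `a` is of Kummer type along `x_j` in the localisation `𝒪_{(x_j)}`.
[cite: Giraud1983, Prop. 1.5] -/
theorem isKummerTypeAt_of_kummerForm : ∀ {O : Type*} [CommRing O] [IsRegularLocalRing O] (p : ℕ) {r : ℕ} (x : Fin r → O), (∀ j, x j ∈ IsLocalRing.maximalIdeal O) → (∀ α : Fin r → O, ∑ i, α i * x i ∈ IsLocalRing.maximalIdeal O ^ 2 → ∀ i, α i ∈ IsLocalRing.maximalIdeal O) → ∀ (a g : O) (v : Oˣ) (A : Fin r → ℕ), a = g ^ p + (v : O) * ∏ j, x j ^ A j → ∀ (j : Fin r), ¬ p ∣ A j → ∀ (L : Type*) [CommRing L] [Algebra O L] [(Ideal.span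 {x j}).IsPrime] [IsLocalization.AtPrime L (Ideal.span {x j})], IsKummerTypeAt p (algebraMap O L (x j)) (algebraMap O L a) := by
  intro O _ _ p r x hx hli a g v A ha j hA L _ _ _ _
  refine isKummerTypeAt_algebraMap (Ideal.span {x j}) L
    (unit_mul_prod_erase_notMem hx hli v.isUnit A j) hA (g := g) ?_
  rw [ha, prod_pow_eq_prod_erase_mul x A j, mul_assoc]

/-- **Kummer form at a point, `p ∣ A_j`, `p ∤ A_{j₁}` ⇒ wound type along `D_j`.** With
notation as above, if `p ∣ A_j` and some other exponent `A_{j₁}` is prime to `p`, then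
`a = g^p + x_j^{A_j} · U`, `U = v ∏_{i ≠ j} x_i^{A_i}`, is of WOUND type along `x_j` in
`𝒪_{(x_j)}`: the residue of `U` in the regular domain `𝒪/(x_j)` has multiplicity `A_{j₁}` at the
prime `x̄_{j₁}`, so `U` is not a `p`-th power in `Frac(𝒪/(x_j))`. [cite: Giraud1983, Prop. 1.5] -/
theorem isWoundTypeAt_of_kummerForm : ∀ {O : Type*} [CommRing O] [IsRegularLocalRing O] (p : ℕ) [Fact p.Prime] {r : ℕ} (x : Fin r → O), (∀ j, x j ∈ IsLocalRing.maximalIdeal O) → (∀ α : Fin r → O, ∑ i, α i * x i ∈ IsLocalRing.maximalIdeal O ^ 2 → ∀ i, α i ∈ IsLocalRing.maximalIdeal O) → ∀ (a g : O) (v : Oˣ) (A : Fin r → ℕ), a = g ^ p + (v : O) * ∏ j, x j ^ A j → ∀ (j j₁ : Fin r), p ∣ A j → ¬ p ∣ A j₁ → ∀ (L : Type*) [CommRing L] [Algebra O L] [(Ideal.span {x j}).IsPrime] [IsLocalization.AtPrime L (Ideal.span {x j})], IsWoundTypeAt p (algebraMap O L (x j)) (algebraMap O L a) := by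
  intro O _ _ p _ r x hx hli a g v A ha j j₁ hj hj₁ L _ _ _ _
  classical
  have hp : p.Prime := Fact.out
  obtain ⟨B, hB⟩ := hj
  have hne : j₁ ≠ j := fun h => hj₁ (h ▸ ⟨B, hB⟩)
  set U : O := (v : O) * ∏ i ∈ Finset.univ.erase j, x i ^ A i with hU
  have ha' : a = g ^ p + x j ^ (p * B) * U := by
    rw [ha, prod_pow_eq_prod_erase_mul x A j, hB]; ring
  -- the quotient `𝒪/(x_j)` is a regular local ring, hence a Noetherian domain
  haveI := (RegularParameters.isRegularLocalRing_quotient_span_singleton hx hli j).1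
  haveI := isDomain_of_isRegularLocalRing (O ⧸ Ideal.span {x j})
  refine isWoundTypeAt_algebraMap (Ideal.span {x j}) L (Ideal.mem_span_singleton_self _) ?_ ha'
  -- multiplicity count at the prime `x̄_{j₁}`
  have hπ := RegularParameters.prime_mk_apply hx hli hne
  refine forall_mul_pow_sub_pow_notMem_of_emultiplicity (Ideal.span {x j}) hp.ne_zero hπ ?_ hj₁
  have hj₁mem : j₁ ∈ Finset.univ.erase j := Finset.mem_erase.mpr ⟨hne, Finset.mem_univ _⟩
  have hUeq : Ideal.Quotient.mk (Ideal.span {x j}) U =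
      Ideal.Quotient.mk _ (v : O) * Ideal.Quotient.mk _ (x j₁) ^ A j₁ *
        ∏ i ∈ (Finset.univ.erase j).erase j₁, Ideal.Quotient.mk _ (x i) ^ A i := by
    rw [hU, ← Finset.mul_prod_erase _ _ hj₁mem, map_mul, map_mul, map_pow, map_prod]
    simp only [map_pow]
    ring
  rw [hUeq]
  refine emultiplicity_unit_mul_pow_mul_prod hπ ((v.isUnit).map _) (A j₁) _ _ A ?_
  intro i hi
  obtain ⟨hi₁, hi⟩ := Finset.mem_erase.mp hi
  exact RegularParameters.not_dvd_mk_apply hli (Finset.ne_of_mem_erase hi) hi₁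

/-- **Wound/transversal form at a point ⇒ wound type along every `D_j`.** If
`a = g^p + (∏ x_i^{B_i})^p · u` with `u` wound-or-transversal at the point
(`IsWoundOrTransversalAt`), then `a` is of wound type along each `x_j` in `𝒪_{(x_j)}`: `u` is not
a `p`-th power modulo `(x_j)` (`forall_sub_pow_notMem_of_isWoundOrTransversalAt`), hence — the
regular local ring `𝒪/(x_j)` being integrally closed — not a `p`-th power in `Frac(𝒪/(x_j))`.
[cite: Giraud1983, Prop. 1.5] -/
theorem isWoundTypeAt_of_woundForm : ∀ {O : Type*} [CommRing O] [IsRegularLocalRing O] (p : ℕ) [Fact p.Prime] [CharP O p] {r : ℕ} (x : Fin r → O), (∀ j, x j ∈ IsLocalRing.maximalIdeal O) → (∀ α : Fin r → O, ∑ i, α i * x i ∈ IsLocalRing.maximalIdeal O ^ 2 → ∀ i, α i ∈ IsLocalRing.maximalIdeal O) → ∀ (a g u : O) (B : Fin r → ℕ), IsWoundOrTransversalAt p x u → a = g ^ p + (∏ j, x j ^ B j) ^ p * u → ∀ (j : Fin r) (L : Type*) [CommRing L] [Algebra O L] [(Ideal.span {x j}).IsPrime] [IsLocalization.AtPrime L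 (Ideal.span {x j})], IsWoundTypeAt p (algebraMap O L (x j)) (algebraMap O L a) := by
  intro O _ _ p _ _ r x hx hli a g u B hwt ha j L _ _ _ _
  classical
  have hp : p.Prime := Fact.out
  set m : O := ∏ i ∈ Finset.univ.erase j, x i ^ B i with hm
  have ha' : a = g ^ p + x j ^ (p * B j) * (u * m ^ p) := by
    rw [ha, prod_pow_eq_prod_erase_mul x B j, mul_pow, ← pow_mul, mul_comm (B j) p]; ring
  haveI := (RegularParameters.isRegularLocalRing_quotient_span_singleton hx hli j).1
  haveI := isDomain_of_isRegularLocalRing (O ⧸ Ideal.span {x j})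
  haveI := isIntegrallyClosed_of_isRegularLocalRing (O ⧸ Ideal.span {x j})
  refine isWoundTypeAt_algebraMap (Ideal.span {x j}) L (Ideal.mem_span_singleton_self _) ?_ ha'
  intro s t ht
  -- `m t ∉ (x_j)`
  have hm' : m ∉ Ideal.span {x j} := by
    have := unit_mul_prod_erase_notMem hx hli isUnit_one B j
    rwa [one_mul] at this
  have hmt : m * t ∉ Ideal.span {x j} := fun h => ((Ideal.IsPrime.mem_or_mem ‹_› h).elim hm' ht)
  have hu : ∀ e : O, u - e ^ p ∉ Ideal.span {x j} :=
    forall_sub_pow_notMem_of_isWoundOrTransversalAt (Ideal.span {x j}) hwt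
      (Ideal.span_mono (Set.singleton_subset_iff.mpr ⟨j, rfl⟩))
      ((Ideal.span_singleton_le_iff_mem _).mpr (hx j))
  have key := forall_mul_pow_sub_pow_notMem_of_isIntegrallyClosed (Ideal.span {x j}) hp.pos hu
    s (m * t) hmt
  rwa [mul_pow, ← mul_assoc] at key

/-- **Consistency of the pointwise normal forms: wound along every component ⇒ wound form.** If
`a` is in Giraud normal form at the point (`GiraudNormalFormAt`: wound/transversal form OR
Kummer form) and of wound type along EVERY boundary component through it (in each
`𝒪_{(x_j)}` — a property of the component, readable at any of its points), then the form at
the point is the wound/transversal one: a Kummer form with `p ∤ A_{j₁}` would make `a` of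
Kummer type along `D_{j₁}` (`isKummerTypeAt_of_kummerForm`), which the wound type excludes in
the discrete valuation ring `𝒪_{(x_{j₁})}` (`IsWoundTypeAt.not_isKummerTypeAt`).
[cite: Giraud1983, Prop. 1.5] -/
theorem woundForm_of_forall_isWoundTypeAt : ∀ {O : Type*} [CommRing O] [IsRegularLocalRing O] (p : ℕ) [Fact p.Prime] [CharP O p] {r : ℕ} (x : Fin r → O), (∀ j, x j ∈ IsLocalRing.maximalIdeal O) → (∀ α : Fin r → O, ∑ i, α i * x i ∈ IsLocalRing.maximalIdeal O ^ 2 → ∀ i, α i ∈ IsLocalRing.maximalIdeal O) → ∀ (a : O), GiraudNormalFormAt p x a → (∀ (j : Fin r) [(Ideal.span {x j}).IsPrime], IsWoundTypeAt p (algebraMap O (Localization.AtPrime (Ideal.span {x j})) (x j)) (algebraMap O (Localization.AtPrime (Ideal.span {x j})) a)) → ∃ (g u : O) (B : Fin r → ℕ), IsWoundOrTransversalAt p x u ∧ a = g ^ p + (∏ j, x j ^ B j) ^ p * u := by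
  intro O _ _ p _ _ r x hx hli a hGNF hW
  rcases hGNF with h1 | ⟨g, A, v, ⟨j₁, hj₁⟩, ha⟩
  · exact h1
  · exfalso
    haveI := RegularParameters.isPrime_span_singleton hx hli j₁
    haveI := isDomain_of_isRegularLocalRing O
    let L := Localization.AtPrime (Ideal.span {x j₁})
    have hK := isKummerTypeAt_of_kummerForm p x hx hli a g v A ha j₁ hj₁ L
    obtain ⟨_, hdvr, hirr⟩ := RegularParameters.isDiscreteValuationRing_localization (hx j₁)
      (RegularParameters.notMem_sq hli j₁) L
    haveI := hdvr
    haveI : CharP L p := RegularParameters.charP_localization p (Ideal.span {x j₁}) L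
    exact (hW j₁).not_isKummerTypeAt p hirr hK

end Summit.ResolutionOfSingularities.ResolutionOfSingularities.Theorems.PicoverLocalModel.LocalCharts

end
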